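import Summits.MatrixMultiplication.MatrixMultiplication.Theses.EisensteinValCertificates
import Literature.Computability.AlgebraicComplexity.GroupTheoreticMatMulThmBProofs

set_option linter.dupNamespace false

/-!
# `HomocyclicSTPPDesigns` (crux stmt-MatrixMultiplication-10647, route EisensteinValCertificates):
# regimes, quantifier order and junk — negative-side support (refuter crux attack, 2026-08-17)

Everything `sorry`-free; nothing here proves or refutes the crux
`X′ : ∀ ε > 0, ∃ prime power q, ∃ ℓ, ∃ STPP family in (ℤ/q)^ℓ with q^ℓ < Σᵢ (|Aᵢ||Bᵢ||Cᵢ|)^((2+ε)/3)`.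

* `not_designs_fixed_modulus`, `designs_need_unbounded_modulus` — QUANTIFIER ORDER is load-bearing:
  the strengthening `∃ q ∀ ε ∃ ℓ …` is FALSE; for every prime power `q` one `ε_q > 0` defeats every
  STPP family in every `(ℤ/q)^ℓ` (BCCGNSU 2017 Thm B at exponent `q`, tree theorem
  `BlasiakChurchCohnGrochowNaslundSawinUmans2017_B_holds`). Witnesses of X′ need `q → ∞`.
* `designs_body_of_one_lt`, `noHomocyclic_eps_le_one` — DEGENERATE REGIME: at a fixed `ε > 1` the
  body of X′ holds trivially (`q = 2, ℓ = 1`, the single triple `(univ, {0}, {0})`), so every `ε`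
  witnessing the kill side `NoHomocyclicSTPP = ¬X′` has `ε ≤ 1`; all content of X′ is at `ε → 0`.
* `designs_body_without_primePow` — HYPOTHESIS MUTATION: without `IsPrimePow q` the statement is
  junk-true via `q = 0` (`ZMod 0 = ℤ`, `0^1 = 0 < 1`), so the side condition is load-bearing.
* `stpp_example_Z3_cubed` — a NON-JUNK MODEL of the tree predicate `IsSTPP` with `N = 2` triples of
  2-sets in `(ℤ/3)³` (CKSU 2005 §5 coordinate pattern), by `decide`.
-/

namespace Summit.MatrixMultiplication.MatrixMultiplication.Theorems.HomocyclicSTPPDesigns.Negative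

open Summit.MatrixMultiplication.MatrixMultiplication.Theses.EisensteinValCertificates
open Literature.Computability.AlgebraicComplexity


/-- The single triple `(univ, {0}, {0})` is an STPP family (N = 1) in any additive group. -/
theorem isSTPP_univ_zero_zero {H : Type*} [AddCommGroup H] [Fintype H] [DecidableEq H] :
    IsSTPP (fun _ : Fin 1 => (Finset.univ : Finset H)) (fun _ => ({0} : Finset H))
      (fun _ => ({0} : Finset H)) := by
  intro i j k s _ s' _ t ht t' ht' u hu u' hu' h
  simp only [Finset.mem_singleton] at ht ht' hu hu'
  subst ht ht' hu hu'
  refine ⟨Subsingleton.elim _ _, Subsingleton.elim _ _, ?_, rfl, rfl⟩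
  have : s' - s = 0 := by simpa using h
  exact (sub_eq_zero.1 this).symm

/-- DEGENERATE REGIME: for a fixed ε > 1 the body of `HomocyclicSTPPDesigns` holds trivially
(q = 2, ℓ = 1, N = 1, A = univ, B = C = {0}: the sum is 2^((2+ε)/3) > 2 = q^ℓ). -/
theorem designs_body_of_one_lt (ε : ℝ) (hε : 1 < ε) :
    ∃ q ℓ : ℕ, IsPrimePow q ∧ ∃ (N : ℕ) (A B C : Fin N → Finset (Fin ℓ → ZMod q)),
      IsSTPP A B C ∧ (q : ℝ) ^ ℓ <
        ∑ i, (((A i).card * (B i).card * (C i).card : ℕ) : ℝ) ^ ((2 + ε) / 3) := by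
  refine ⟨2, 1, Nat.prime_two.isPrimePow, 1, fun _ => Finset.univ, fun _ => {0}, fun _ => {0},
    isSTPP_univ_zero_zero, ?_⟩
  have hcard : (Finset.univ : Finset (Fin 1 → ZMod 2)).card = 2 := by
    rw [Finset.card_univ, Fintype.card_fun, ZMod.card, Fintype.card_fin]; norm_num
  simp only [Finset.univ_unique, Finset.sum_singleton, hcard, Finset.card_singleton, mul_one,
    Nat.cast_ofNat, pow_one]
  have h1 : (1 : ℝ) < (2 + ε) / 3 := by linarith
  calc (2 : ℝ) = (2 : ℝ) ^ (1 : ℝ) := (Real.rpow_one 2).symm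
    _ < (2 : ℝ) ^ ((2 + ε) / 3) := Real.rpow_lt_rpow_of_exponent_lt (by norm_num) h1

/-- Hence any ε witnessing the kill side `NoHomocyclicSTPP` satisfies ε ≤ 1 (information for the
prover of the kill ladder: the uniform saving to be proved is < 1, in fact < ω_record − 2). -/
theorem noHomocyclic_eps_le_one (ε : ℝ)
    (h : ∀ q ℓ : ℕ, IsPrimePow q → ∀ (N : ℕ) (A B C : Fin N → Finset (Fin ℓ → ZMod q)),
      IsSTPP A B C → ∑ i, (((A i).card * (B i).card * (C i).card : ℕ) : ℝ) ^ ((2 + ε) / 3) ≤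
        (q : ℝ) ^ ℓ) : ε ≤ 1 := by
  by_contra hlt
  push Not at hlt
  obtain ⟨q, ℓ, hq, N, A, B, C, hS, hsum⟩ := designs_body_of_one_lt ε hlt
  exact absurd (h q ℓ hq N A B C hS) (not_le.2 hsum)

/-- NON-JUNK MODEL of `IsSTPP` with N = 2: in (ℤ/3)³, A₁ = {e₁, 2e₁}, B₁ = {e₂, 2e₂},
C₁ = {e₃, 2e₃}; A₂ = {e₂, 2e₂}, B₂ = {e₃, 2e₃}, C₂ = {e₁, 2e₁} (CKSU 2005 §5 coordinate pattern). -/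
theorem stpp_example_Z3_cubed :
    IsSTPP (N := 2)
      (![({![1, 0, 0], ![2, 0, 0]} : Finset (Fin 3 → ZMod 3)), {![0, 1, 0], ![0, 2, 0]}])
      (![({![0, 1, 0], ![0, 2, 0]} : Finset (Fin 3 → ZMod 3)), {![0, 0, 1], ![0, 0, 2]}])
      (![({![0, 0, 1], ![0, 0, 2]} : Finset (Fin 3 → ZMod 3)), {![1, 0, 0], ![2, 0, 0]}]) := by
  unfold IsSTPP
  decide


/-- QUANTIFIER ORDER is load-bearing: the strengthening `∃ q ∀ ε ∃ ℓ …` of the crux is FALSE — no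
single prime power `q` hosts designs for every `ε` (BCCGNSU 2017 Thm B at exponent `q`, tree
theorem `BlasiakChurchCohnGrochowNaslundSawinUmans2017_B_holds`, uniformly in `ℓ`); witnesses of
`HomocyclicSTPPDesigns` need `q → ∞` as `ε → 0`. -/
theorem not_designs_fixed_modulus :
    ¬ ∃ q : ℕ, IsPrimePow q ∧ ∀ ε : ℝ, 0 < ε →
      ∃ (ℓ N : ℕ) (A B C : Fin N → Finset (Fin ℓ → ZMod q)),
        IsSTPP A B C ∧ (q : ℝ) ^ ℓ <
          ∑ i, (((A i).card * (B i).card * (C i).card : ℕ) : ℝ) ^ ((2 + ε) / 3) := by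
  rintro ⟨q, hq, h⟩
  obtain ⟨ε, hε, hB⟩ := BlasiakChurchCohnGrochowNaslundSawinUmans2017_B_holds q
  obtain ⟨ℓ, N, A, B, C, hS, hlt⟩ := h ε hε
  haveI : NeZero q := ⟨hq.ne_zero⟩
  have hexp : AddMonoid.exponent (Fin ℓ → ZMod q) ≤ q := by
    refine AddMonoid.exponent_min' q hq.pos ?_
    intro g
    funext i
    simp [nsmul_eq_mul]
  have hle := hB (Fin ℓ → ZMod q) hexp N A B C hS
  have hcard : (Fintype.card (Fin ℓ → ZMod q) : ℝ) = (q : ℝ) ^ ℓ := by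
    rw [Fintype.card_fun, ZMod.card, Fintype.card_fin]; push_cast; rfl
  rw [hcard] at hle
  exact absurd hle (not_le.2 hlt)

/-- The same in the crux's own quantifier shape with `q` pulled out: for every prime power `q`
there is `ε > 0` defeating every STPP family in every `(ℤ/q)^ℓ`. -/
theorem designs_need_unbounded_modulus (q : ℕ) (hq : IsPrimePow q) :
    ∃ ε : ℝ, 0 < ε ∧ ∀ (ℓ N : ℕ) (A B C : Fin N → Finset (Fin ℓ → ZMod q)), IsSTPP A B C →
      ∑ i, (((A i).card * (B i).card * (C i).card : ℕ) : ℝ) ^ ((2 + ε) / 3) ≤ (q : ℝ) ^ ℓ := by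
  by_contra hcon
  push Not at hcon
  exact not_designs_fixed_modulus ⟨q, hq, fun ε hε => by
    obtain ⟨ℓ, N, A, B, C, hS, hlt⟩ := hcon ε hε
    exact ⟨ℓ, N, A, B, C, hS, hlt⟩⟩

/-- HYPOTHESIS MUTATION: dropping `IsPrimePow q` makes the crux JUNK-TRUE via `q = 0`
(`ZMod 0 = ℤ`, `(0:ℝ)^1 = 0 < 1` for the single triple `({0},{0},{0})`), so the side condition
(at least `q ≠ 0`) is load-bearing against junk. -/
theorem designs_body_without_primePow (ε : ℝ) :
    ∃ q ℓ : ℕ, ∃ (N : ℕ) (A B C : Fin N → Finset (Fin ℓ → ZMod q)),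
      IsSTPP A B C ∧ (q : ℝ) ^ ℓ <
        ∑ i, (((A i).card * (B i).card * (C i).card : ℕ) : ℝ) ^ ((2 + ε) / 3) := by
  refine ⟨0, 1, 1, fun _ => {0}, fun _ => {0}, fun _ => {0}, ?_, ?_⟩
  · intro i j k s hs s' hs' t ht t' ht' u hu u' hu' _
    simp only [Finset.mem_singleton] at hs hs' ht ht' hu hu'
    subst hs hs' ht ht' hu hu'
    exact ⟨Subsingleton.elim _ _, Subsingleton.elim _ _, rfl, rfl, rfl⟩
  · simp

end Summit.MatrixMultiplication.MatrixMultiplication.Theorems.HomocyclicSTPPDesigns.Negative
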